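import Summits.NavierStokesRegularity.NavierStokesRegularity.Theorems.ScenarioCensusTemporalSpectrumComplex
import Summits.NavierStokesRegularity.NavierStokesRegularity.Theorems.ScenarioCensusModeRankShell
import HarnessLib

/-!
# LINE «temporal-spectrum» port, part 7/12: §K (b) — `cs_decay`, `cs_identity`, `csX` / `csY`, `cs_group_tendsto`, `Row_A1cs`

Re-homed for the scenario census (typer seat ns-census-typer-1 g8; the cells A1ex / A1po are MEMBERS OF RECORD «DECIDED IN KERNEL IN FILES» of row A1apT since census
v1.69 and A1jb / A1cs / A1qx / A1cx since v1.71 (critic idea-crit-3 g6 PASS — no price 20:33:05Z, RE-STAMPs REV 2 → REV 3 → REV 4 22:13:50Z; ref ns-census-ref g8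
PRE-CHECK ✓ §13.14 item 11 + items 19/20; lit §21.21 / §21.24 (a)); this port makes them TREE-decided): VERBATIM PORT of ns-idea-2 LINE g12-2 «temporal-spectrum»
REV 4, `pub/ideators/ns-idea-2/lines/temporal-spectrum/line-temporal-spectrum.lean` sha16 f2331f3a0765e1d4 (3431 l., lean check rc 0, 0 sorry), split for the
400-line rule into twelve parts `ScenarioCensusTemporalSpectrum{∅, Exponential, Oscillatory, OscillatoryRow, Jordan, Complex, ComplexDecay, ComplexRow, Quasi, QuasiGroup,
QuasiRow, Head}` (chain imports).  Lean text VERBATIM in namespace `…Theorems.ScenarioCensus.TemporalSpectrum` (the line's `…Lines.TemporalSpectrum` re-homed);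
port edits: the two `local notation "E3"` lines → one `abbrev E3` at namespace level and the bracket lines `section Rows` / `end Rows` dropped (no `variable`s
there; typer lint: no notation in port files), `@[conjecture]` on the OPEN head `Row_A1qp` (typed only), twenty-one one-line docstrings added (gate lint); the
lemmas the line shares VERBATIM with «mode-rank» / «floquet-meter» (§B spatial Liouville lemmas, the instrument `vortB` / `vortB_sum_sum`, the gauge
`tendsto_slice_atBot` / `eq_zero_of_curl_slice_const`, `laplacian_zero_apply`, `norm_curl_le_four_mul`) are taken BY NAME from those landed ports (listed
below); `tendsto_typeI_bound` (twin of a landed tree lemma in a module the farm does not build) is not re-declared and its four uses carry the one-line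
Mathlib proof inline (proof text only).  Statements untouched.

No census VALUE is moved here (row A1apT keeps its value; the members become TREE-decided by name); NS regularity is NOT proved; (L′) ⟨10661⟩ is
untouched; no summit statement is proved by this file. Lemmas that restate already-landed tree declarations are taken BY NAME (gate lint `dedup.landed`): `apply_eq_apply_of_harmonic_bounded` = `ModeRank.apply_eq_apply_of_harmonic_bounded`, `apply_eq_apply_of_curl_const` = `ModeRank.apply_eq_apply_of_curl_const`, `nonpos_of_laplacian_eq_mul` = `ModeRank.nonpos_of_laplacian_eq_mul`, `eq_zero_of_laplacian_eq_smul_of_pos` = `ModeRank.eq_zero_of_laplacian_eq_smul_of_pos`, `vortB` = `ModeRank.vortB`, `vortB_sum_sum` = `ModeRank.vortB_sum_sum`, `tendsto_slice_atBot` = `ModeRank.tendsto_slice_atBot`, `eq_zero_of_curl_slice_const` = `ModeRank.eq_zero_of_curl_slice_const`, `laplacian_zero_apply` = `ModeRank.laplacian_zero_fun`, `norm_curl_le_four_mul` = `FloquetMeter.norm_curl_le_four_mul`.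
-/

-- the summit and its single problem share the name `NavierStokesRegularity` (D-0017 nested layout)
set_option linter.dupNamespace false

noncomputable section

open Set Function Filter Topology

namespace Summit.NavierStokesRegularity.NavierStokesRegularity.Theorems.ScenarioCensus.TemporalSpectrum

open Literature.Analysis Literature.Analysis.FluidPDE InnerProductSpace
open Summit.NavierStokesRegularity.NavierStokesRegularity.Theorems (vorticity_eq_deriv_of_typeI)
open scoped Laplacian InnerProductSpace RealInnerProductSpace ContDiff

/-- **Step 1 of Row A1cs: modes of non-positive real part vanish** (dominant balance by real part
with the Type-I decay, then independence of the frequencies; induction from the smallest real part). -/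
theorem cs_decay {C : ℝ} {u : ℝ → E3 → E3} (hu : IsTypeIAncientMild C u) {n : ℕ}
    {a b : Fin n → ℝ} {ψ χ : Fin n → E3 → E3} (hb0 : ∀ k, 0 ≤ b k)
    (hinj : Function.Injective (fun k => (a k, b k)))
    (hsl' : ∀ s < 0, ∀ y, u s y = ∑ m, (Real.exp (csν a m * s) * csT b s m) • csΦ ψ χ m y) :
    ∀ k, a k ≤ 0 → (∀ x, ψ k x = 0) ∧ (b k ≠ 0 → ∀ x, χ k x = 0) := by
  classical
  by_contra hcon
  obtain ⟨k₁, hk₁⟩ := not_forall.1 hcon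
  set S : Finset (Fin n) := Finset.univ.filter
    (fun k => ¬ (a k ≤ 0 → (∀ x, ψ k x = 0) ∧ (b k ≠ 0 → ∀ x, χ k x = 0))) with hS
  have hSne : S.Nonempty :=
    ⟨k₁, by simp only [hS, Finset.mem_filter, Finset.mem_univ, true_and]; exact hk₁⟩
  obtain ⟨k₀, hk₀S, hmin⟩ := S.exists_min_image a hSne
  have hk₀ := (Finset.mem_filter.1 hk₀S).2
  rw [Classical.not_imp] at hk₀
  obtain ⟨hr0, hbad⟩ := hk₀
  have hgood : ∀ k, a k < a k₀ → (∀ x, ψ k x = 0) ∧ (b k ≠ 0 → ∀ x, χ k x = 0) := by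
    intro k hk
    by_contra hk'
    have hkS : k ∈ S := by
      simp only [hS, Finset.mem_filter, Finset.mem_univ, true_and, Classical.not_imp]
      exact ⟨by linarith, hk'⟩
    exact absurd (hmin k hkS) (not_le.2 hk)
  apply hbad
  -- the group of real part `a k₀` tends to zero at every point
  have hgrp : ∀ x, Tendsto (fun t : ℝ => ∑ k ∈ Finset.univ.filter (fun k => a k = a k₀),
      (Real.cos (b k * t) • ψ k x + Real.sin (b k * t) • χ k x)) atBot (𝓝 0) := by
    intro x
    have hb' : ∀ m : Fin n ⊕ Fin n, ∃ M : ℝ, ∀ t : ℝ, ‖csT b t m • csΦ ψ χ m x‖ ≤ M := by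
      intro m
      refine ⟨‖csΦ ψ χ m x‖, fun t => ?_⟩
      rw [norm_smul, Real.norm_eq_abs]
      exact mul_le_of_le_one_left (norm_nonneg _) (abs_csT_le b t m)
    have hz' : ∀ m : Fin n ⊕ Fin n, csν a m < a k₀ → ∀ t : ℝ, csT b t m • csΦ ψ χ m x = 0 := by
      rintro (k | k) hk t
      · simp only [csν_inl] at hk
        simp only [csΦ_inl, (hgood k hk).1 x, smul_zero]
      · simp only [csν_inr] at hk
        by_cases hbk : b k = 0
        · simp [csT_inr, hbk]
        · simp only [csΦ_inr, (hgood k hk).2 hbk x, smul_zero]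
    have hw : Tendsto (fun t : ℝ => Real.exp (-(a k₀ * t)) •
        ∑ m, Real.exp (csν a m * t) • (csT b t m • csΦ ψ χ m x)) atBot (𝓝 0) := by
      have h1 : Tendsto (fun t : ℝ => Real.exp (-(a k₀ * t)) • u t x) atBot (𝓝 0) := by
        refine squeeze_zero_norm' ?_ ((show Tendsto (fun s : ℝ => C / Real.sqrt (-s)) atBot (𝓝 0) from (Real.tendsto_sqrt_atTop.comp tendsto_neg_atBot_atTop).const_div_atTop C))
        filter_upwards [Iio_mem_atBot (0 : ℝ)] with t ht
        have he1 : Real.exp (-(a k₀ * t)) ≤ 1 :=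
          Real.exp_le_one_iff.2 (neg_nonpos.2 (mul_nonneg_of_nonpos_of_nonpos hr0 (le_of_lt ht)))
        rw [norm_smul, Real.norm_eq_abs, abs_of_pos (Real.exp_pos _)]
        exact (mul_le_of_le_one_left (norm_nonneg _) he1).trans (hu.norm_le ht x)
      refine h1.congr' ?_
      filter_upwards [Iio_mem_atBot (0 : ℝ)] with t ht
      rw [hsl' t ht x]
      simp only [smul_smul]
    have G := tendsto_group_of_weighted (csν a) (fun m t => csT b t m • csΦ ψ χ m x) hb' (a k₀)
      hz' hw
    refine G.congr fun t => ?_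
    rw [show (Finset.univ.filter fun m => csν a m = a k₀)
        = Finset.univ.filter (fun m : Fin n ⊕ Fin n => Sum.elim a a m = a k₀) from rfl,
      sum_filter_sumType]
    rfl
  have hInj : Set.InjOn b ↑(Finset.univ.filter (fun k => a k = a k₀)) := by
    intro k hk k' hk' hbb
    simp only [Finset.coe_filter, Finset.mem_univ, true_and, Set.mem_setOf_eq] at hk hk'
    exact hinj (Prod.ext (by simp [hk, hk']) hbb)
  have hk₀mem : k₀ ∈ Finset.univ.filter (fun k => a k = a k₀) := by simp
  have key := fun x => trig_coeff_eq_zero (Finset.univ.filter (fun k => a k = a k₀)) b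
    (fun k => ψ k x) (fun k => χ k x) (fun k _ => hb0 k) hInj (hgrp x) k₀ hk₀mem
  exact ⟨fun x => (key x).1, fun hb x => (key x).2 hb⟩

/-- **Step 2 of Row A1cs: the vorticity equation along the modes** — linear part, quadratic part and
diffusion, with the time derivative of `e^{aₖt}cos(bₖt)`, `e^{aₖt}sin(bₖt)` computed. -/
theorem cs_identity {C : ℝ} {u : ℝ → E3 → E3} (hu : IsTypeIAncientMild C u) {n : ℕ}
    {a b : Fin n → ℝ} {ψ χ : Fin n → E3 → E3} (hψ : ∀ k, ContDiff ℝ 3 (ψ k))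
    (hχ : ∀ k, ContDiff ℝ 3 (χ k))
    (hsl' : ∀ s < 0, ∀ y, u s y = ∑ m, (Real.exp (csν a m * s) * csT b s m) • csΦ ψ χ m y) :
    ∀ t < 0, ∀ x,
      ∑ m, (Real.exp (csν a m * t) * (csν a m * csT b t m + csD b t m)) • curl (csΦ ψ χ m) x
        + ∑ i, ∑ j, ((Real.exp (csν a i * t) * csT b t i) * (Real.exp (csν a j * t) * csT b t j))
            • ModeRank.vortB (csΦ ψ χ i) (curl (csΦ ψ χ j)) x
        - ∑ m, (Real.exp (csν a m * t) * csT b t m) • (Δ (curl (csΦ ψ χ m))) x = 0 := by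
  classical
  have hΦ : ∀ m, ContDiff ℝ 3 (csΦ ψ χ m) := by rintro (k | k); exacts [hψ k, hχ k]
  have hcΦ : ∀ m, ContDiff ℝ 2 (curl (csΦ ψ χ m)) := fun m => contDiff_curl (hΦ m)
  have hdΦ : ∀ m, Differentiable ℝ (csΦ ψ χ m) := fun m => (hΦ m).differentiable (by norm_num)
  have hslF : ∀ s < 0, u s = fun y => ∑ m, (Real.exp (csν a m * s) * csT b s m) • csΦ ψ χ m y :=
    fun s hs => funext (hsl' s hs)
  have hcurl : ∀ s < 0, curl (u s)
      = fun y => ∑ m, (Real.exp (csν a m * s) * csT b s m) • curl (csΦ ψ χ m) y := by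
    intro s hs; funext y; rw [hslF s hs]; exact curl_sum_smul' hdΦ _ y
  intro t ht x
  have h2 := vorticity_eq_deriv_of_typeI hu ht x
  have hd : deriv (fun s => curl (u s) x) t
      = ∑ m, (Real.exp (csν a m * t) * (csν a m * csT b t m + csD b t m))
          • curl (csΦ ψ χ m) x := by
    have hev : (fun s => curl (u s) x) =ᶠ[𝓝 t]
        fun s => ∑ m, (Real.exp (csν a m * s) * csT b s m) • curl (csΦ ψ χ m) x := by
      filter_upwards [Iio_mem_nhds ht] with s hs
      rw [hcurl s hs]
    rw [hev.deriv_eq]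
    exact (hasDerivAt_sum_smul' (c := fun s m => Real.exp (csν a m * s) * csT b s m)
      (c' := fun m => Real.exp (csν a m * t) * (csν a m * csT b t m + csD b t m))
      (fun m => curl (csΦ ψ χ m) x) fun m => hasDerivAt_csCoeff a b m t).deriv
  have hB : fderiv ℝ (curl (u t)) x (u t x) - fderiv ℝ (u t) x (curl (u t) x)
      = ∑ i, ∑ j, ((Real.exp (csν a i * t) * csT b t i) * (Real.exp (csν a j * t) * csT b t j))
          • ModeRank.vortB (csΦ ψ χ i) (curl (csΦ ψ χ j)) x := by
    have := ModeRank.vortB_sum_sum (csΦ ψ χ) (fun j => curl (csΦ ψ χ j))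
      (fun i => Real.exp (csν a i * t) * csT b t i)
      (fun j => Real.exp (csν a j * t) * csT b t j) (x := x) (fun l => hdΦ l x)
      (fun j => (hcΦ j).differentiable (by norm_num) x)
    rw [hcurl t ht, hslF t ht]
    simpa only [ModeRank.vortB] using this
  have hL : (Δ (curl (u t))) x
      = ∑ m, (Real.exp (csν a m * t) * csT b t m) • (Δ (curl (csΦ ψ χ m))) x := by
    rw [hcurl t ht]; exact laplacian_sum_smul' hcΦ _ x
  have h3 : deriv (fun s => curl (u s) x) t
      + (fderiv ℝ (curl (u t)) x (u t x) - fderiv ℝ (u t) x (curl (u t) x))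
      - (Δ (curl (u t))) x = 0 := by rw [← sub_eq_zero.2 h2]; abel
  rw [hd, hB, hL] at h3
  exact h3

/-- The cosine coefficient of mode `k` in the linear part of the vorticity identity at real part
`aₖ`: `aₖ ωψₖ + bₖ ωχₖ - Δωψₖ`. -/
def csX {n : ℕ} (a b : Fin n → ℝ) (ψ χ : Fin n → E3 → E3) (x : E3) (k : Fin n) : E3 :=
  a k • curl (ψ k) x + b k • curl (χ k) x - (Δ (curl (ψ k))) x
/-- The sine coefficient: `aₖ ωχₖ - bₖ ωψₖ - Δωχₖ`. -/
def csY {n : ℕ} (a b : Fin n → ℝ) (ψ χ : Fin n → E3 → E3) (x : E3) (k : Fin n) : E3 :=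
  a k • curl (χ k) x - b k • curl (ψ k) x - (Δ (curl (χ k))) x

/-- Unfolding `csX`. -/
theorem csX_apply {n : ℕ} (a b : Fin n → ℝ) (ψ χ : Fin n → E3 → E3) (x : E3) (k : Fin n) :
    csX a b ψ χ x k = a k • curl (ψ k) x + b k • curl (χ k) x - (Δ (curl (ψ k))) x := rfl
/-- Unfolding `csY`. -/
theorem csY_apply {n : ℕ} (a b : Fin n → ℝ) (ψ χ : Fin n → E3 → E3) (x : E3) (k : Fin n) :
    csY a b ψ χ x k = a k • curl (χ k) x - b k • curl (ψ k) x - (Δ (curl (χ k))) x := rfl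

/-- **Step 3a of Row A1cs: the linear group of the smallest vorticity-carrying real part tends to
zero** (dominant balance applied to `L = -Q`; the quadratic couplings of total real part `≤ r` vanish
identically because one of the two factors is an invisible mode). -/
theorem cs_group_tendsto {n : ℕ} {a b : Fin n → ℝ} {ψ χ : Fin n → E3 → E3}
    (hdec : ∀ k, a k ≤ 0 → (∀ x, ψ k x = 0) ∧ (b k ≠ 0 → ∀ x, χ k x = 0)) {r : ℝ}
    (hlow : ∀ k, a k < r → curl (ψ k) = 0 ∧ (b k ≠ 0 → curl (χ k) = 0))
    (hE : ∀ t < 0, ∀ x,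
      ∑ m, (Real.exp (csν a m * t) * (csν a m * csT b t m + csD b t m)) • curl (csΦ ψ χ m) x
        + ∑ i, ∑ j, ((Real.exp (csν a i * t) * csT b t i) * (Real.exp (csν a j * t) * csT b t j))
            • ModeRank.vortB (csΦ ψ χ i) (curl (csΦ ψ χ j)) x
        - ∑ m, (Real.exp (csν a m * t) * csT b t m) • (Δ (curl (csΦ ψ χ m))) x = 0) (x : E3) :
    Tendsto (fun t : ℝ => ∑ k ∈ Finset.univ.filter (fun k => a k = r),
      (Real.cos (b k * t) • csX a b ψ χ x k + Real.sin (b k * t) • csY a b ψ χ x k))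
      atBot (𝓝 0) := by
  classical
  have hsin0 : ∀ k, b k = 0 → ∀ s, csT b s (Sum.inr k) = 0 := by
    intro k hk s; simp [csT_inr, hk]
  have hD0 : ∀ k, b k = 0 → ∀ s, csD b s (Sum.inr k) = 0 := by
    intro k hk s; simp [csD_inr, hk]
  -- velocity modes of real part `≤ 0` and vorticity modes of real part `< r` are invisible
  have hvel0 : ∀ m : Fin n ⊕ Fin n, csν a m ≤ 0 → ∀ s,
      (Real.exp (csν a m * s) * csT b s m) • csΦ ψ χ m = 0 := by
    rintro (k | k) hk s
    · simp only [csν_inl] at hk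
      have h0 : ψ k = 0 := funext (hdec k hk).1
      simp [csΦ_inl, h0]
    · simp only [csν_inr] at hk
      by_cases hbk : b k = 0
      · rw [hsin0 k hbk, mul_zero, zero_smul]
      · have h0 : χ k = 0 := funext ((hdec k hk).2 hbk)
        simp [csΦ_inr, h0]
  have hvor0 : ∀ m : Fin n ⊕ Fin n, csν a m < r → ∀ s,
      (Real.exp (csν a m * s) * csT b s m) • curl (csΦ ψ χ m) = 0 := by
    rintro (k | k) hk s
    · simp only [csν_inl] at hk
      simp [csΦ_inl, (hlow k hk).1]
    · simp only [csν_inr] at hk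
      by_cases hbk : b k = 0
      · rw [hsin0 k hbk, mul_zero, zero_smul]
      · simp [csΦ_inr, (hlow k hk).2 hbk]
  -- the linear trigonometric factors
  set g : Fin n ⊕ Fin n → ℝ → E3 := fun m t =>
    (csν a m * csT b t m + csD b t m) • curl (csΦ ψ χ m) x
      - csT b t m • (Δ (curl (csΦ ψ χ m))) x with hg
  have hgb : ∀ m, ∃ M : ℝ, ∀ t, ‖g m t‖ ≤ M := by
    intro m
    refine ⟨(|csν a m| + |Sum.elim b b m|) * ‖curl (csΦ ψ χ m) x‖
      + ‖(Δ (curl (csΦ ψ χ m))) x‖, fun t => ?_⟩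
    have h1 : |csν a m * csT b t m + csD b t m| ≤ |csν a m| + |Sum.elim b b m| := by
      have e1 : |csν a m * csT b t m| ≤ |csν a m| := by
        rw [abs_mul]
        exact mul_le_of_le_one_right (abs_nonneg _) (abs_csT_le b t m)
      exact (abs_add_le _ _).trans (add_le_add e1 (abs_csD_le b t m))
    have h2 : ‖g m t‖ ≤ ‖(csν a m * csT b t m + csD b t m) • curl (csΦ ψ χ m) x‖
        + ‖csT b t m • (Δ (curl (csΦ ψ χ m))) x‖ := by
      simp only [hg]; exact norm_sub_le _ _
    have h3 : ‖(csν a m * csT b t m + csD b t m) • curl (csΦ ψ χ m) x‖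
        ≤ (|csν a m| + |Sum.elim b b m|) * ‖curl (csΦ ψ χ m) x‖ := by
      rw [norm_smul, Real.norm_eq_abs]
      exact mul_le_mul_of_nonneg_right h1 (norm_nonneg _)
    have h4 : ‖csT b t m • (Δ (curl (csΦ ψ χ m))) x‖ ≤ ‖(Δ (curl (csΦ ψ χ m))) x‖ := by
      rw [norm_smul, Real.norm_eq_abs]
      exact mul_le_of_le_one_left (norm_nonneg _) (abs_csT_le b t m)
    exact h2.trans (add_le_add h3 h4)
  have hgz : ∀ m, csν a m < r → ∀ t, g m t = 0 := by
    rintro (k | k) hk t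
    · simp only [csν_inl] at hk
      have h0 : curl (ψ k) = 0 := (hlow k hk).1
      simp only [hg, csΦ_inl, h0, Pi.zero_apply, smul_zero, ModeRank.laplacian_zero_fun, sub_zero]
    · simp only [csν_inr] at hk
      by_cases hbk : b k = 0
      · simp only [hg, hsin0 k hbk t, hD0 k hbk t, csν_inr, mul_zero, add_zero, zero_smul,
          sub_zero]
      · have h0 : curl (χ k) = 0 := (hlow k hk).2 hbk
        simp only [hg, csΦ_inr, h0, Pi.zero_apply, smul_zero, ModeRank.laplacian_zero_fun, sub_zero]
  -- the weighted quadratic remainder tends to zero, pair by pair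
  have hpair : ∀ i j : Fin n ⊕ Fin n, Tendsto (fun t : ℝ => Real.exp (-(r * t)) •
      (((Real.exp (csν a i * t) * csT b t i) * (Real.exp (csν a j * t) * csT b t j))
        • ModeRank.vortB (csΦ ψ χ i) (curl (csΦ ψ χ j)) x)) atBot (𝓝 0) := by
    intro i j
    by_cases hij : r < csν a i + csν a j
    · -- decaying weight
      have he : Tendsto (fun t : ℝ => Real.exp ((csν a i + csν a j - r) * t)) atBot (𝓝 0) :=
        Real.tendsto_exp_atBot.comp (tendsto_id.const_mul_atBot (sub_pos.2 hij))
      have heM : Tendsto (fun t : ℝ => Real.exp ((csν a i + csν a j - r) * t)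
          * ‖ModeRank.vortB (csΦ ψ χ i) (curl (csΦ ψ χ j)) x‖) atBot (𝓝 0) := by
        simpa using he.mul_const ‖ModeRank.vortB (csΦ ψ χ i) (curl (csΦ ψ χ j)) x‖
      refine squeeze_zero_norm' (Eventually.of_forall fun t => ?_) heM
      rw [norm_smul, norm_smul, Real.norm_of_nonneg (Real.exp_pos _).le, Real.norm_eq_abs,
        ← mul_assoc]
      refine mul_le_mul_of_nonneg_right ?_ (norm_nonneg _)
      have hprod : Real.exp (-(r * t)) * (Real.exp (csν a i * t) * Real.exp (csν a j * t))
          = Real.exp ((csν a i + csν a j - r) * t) := by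
        rw [← Real.exp_add, ← Real.exp_add]; congr 1; ring
      have hc1 := abs_csT_le b t i
      have hc2 := abs_csT_le b t j
      rw [abs_mul, abs_mul, abs_mul, Real.abs_exp, Real.abs_exp]
      calc Real.exp (-(r * t)) * (Real.exp (csν a i * t) * |csT b t i|
            * (Real.exp (csν a j * t) * |csT b t j|))
          = Real.exp ((csν a i + csν a j - r) * t) * (|csT b t i| * |csT b t j|) := by
            rw [← hprod]; ring
        _ ≤ Real.exp ((csν a i + csν a j - r) * t) * (1 * 1) := by
            refine mul_le_mul_of_nonneg_left ?_ (Real.exp_pos _).le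
            exact mul_le_mul hc1 hc2 (abs_nonneg _) zero_le_one
        _ = Real.exp ((csν a i + csν a j - r) * t) := by ring
    · -- the coupling vanishes identically
      push Not at hij
      refine tendsto_const_nhds.congr fun t => ?_
      symm
      rw [smul_eq_zero]
      right
      rcases le_or_gt (csν a i) 0 with hi | hi
      · have h0 := hvel0 i hi t
        by_cases hci : Real.exp (csν a i * t) * csT b t i = 0
        · rw [hci, zero_mul, zero_smul]
        · have hΦ0 : csΦ ψ χ i = 0 := by
            have := congrArg (fun F => (Real.exp (csν a i * t) * csT b t i)⁻¹ • F) h0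
            simpa only [smul_smul, inv_mul_cancel₀ hci, one_smul, smul_zero] using this
          rw [hΦ0, vortB_zero_left, smul_zero]
      · have hj : csν a j < r := by linarith
        have h0 := hvor0 j hj t
        by_cases hcj : Real.exp (csν a j * t) * csT b t j = 0
        · rw [hcj, mul_zero, zero_smul]
        · have hω0 : curl (csΦ ψ χ j) = 0 := by
            have := congrArg (fun F => (Real.exp (csν a j * t) * csT b t j)⁻¹ • F) h0
            simpa only [smul_smul, inv_mul_cancel₀ hcj, one_smul, smul_zero] using this
          rw [hω0, vortB_zero_right, smul_zero]
  have hQ : Tendsto (fun t : ℝ => Real.exp (-(r * t)) •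
      ∑ i, ∑ j, ((Real.exp (csν a i * t) * csT b t i) * (Real.exp (csν a j * t) * csT b t j))
        • ModeRank.vortB (csΦ ψ χ i) (curl (csΦ ψ χ j)) x) atBot (𝓝 0) := by
    have h0 : Tendsto (fun t : ℝ => ∑ i, ∑ j, Real.exp (-(r * t)) •
        (((Real.exp (csν a i * t) * csT b t i) * (Real.exp (csν a j * t) * csT b t j))
          • ModeRank.vortB (csΦ ψ χ i) (curl (csΦ ψ χ j)) x)) atBot (𝓝 0) := by
      rw [show (0 : E3) = ∑ i : Fin n ⊕ Fin n, ∑ j : Fin n ⊕ Fin n, (0 : E3) by simp]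
      exact tendsto_finsetSum _ fun i _ => tendsto_finsetSum _ fun j _ => hpair i j
    refine h0.congr fun t => ?_
    simp only [Finset.smul_sum]
  -- `L = -Q` along the slices
  have hLQ : ∀ t < 0, ∑ m, Real.exp (csν a m * t) • g m t
      = -∑ i, ∑ j, ((Real.exp (csν a i * t) * csT b t i)
          * (Real.exp (csν a j * t) * csT b t j)) • ModeRank.vortB (csΦ ψ χ i) (curl (csΦ ψ χ j)) x := by
    intro t ht
    have h := hE t ht x
    have hLg : ∑ m, Real.exp (csν a m * t) • g m t
        = ∑ m, (Real.exp (csν a m * t) * (csν a m * csT b t m + csD b t m))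
            • curl (csΦ ψ χ m) x
          - ∑ m, (Real.exp (csν a m * t) * csT b t m) • (Δ (curl (csΦ ψ χ m))) x := by
      rw [← Finset.sum_sub_distrib]
      refine Finset.sum_congr rfl fun m _ => ?_
      simp only [hg, smul_sub, smul_smul]
    rw [hLg]
    generalize hA : (∑ m, (Real.exp (csν a m * t) * (csν a m * csT b t m + csD b t m))
      • curl (csΦ ψ χ m) x) = A at h ⊢
    generalize hBq : (∑ i, ∑ j, ((Real.exp (csν a i * t) * csT b t i)
      * (Real.exp (csν a j * t) * csT b t j)) • ModeRank.vortB (csΦ ψ χ i) (curl (csΦ ψ χ j)) x) = Bq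
      at h ⊢
    generalize hCl : (∑ m, (Real.exp (csν a m * t) * csT b t m)
      • (Δ (curl (csΦ ψ χ m))) x) = Cl at h ⊢
    rw [← sub_eq_zero, ← h]
    abel
  have hw : Tendsto (fun t : ℝ => Real.exp (-(r * t)) • ∑ m, Real.exp (csν a m * t) • g m t)
      atBot (𝓝 0) := by
    have hneg := hQ.neg
    rw [neg_zero] at hneg
    refine hneg.congr' ?_
    filter_upwards [Iio_mem_atBot (0 : ℝ)] with t ht
    rw [hLQ t ht, smul_neg]
  have G := tendsto_group_of_weighted (csν a) g hgb r hgz hw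
  refine G.congr fun t => ?_
  rw [show (Finset.univ.filter fun m => csν a m = r)
      = Finset.univ.filter (fun m : Fin n ⊕ Fin n => Sum.elim a a m = r) from rfl,
    sum_filter_sumType]
  refine Finset.sum_congr rfl fun k _ => ?_
  simp only [hg, csν_inl, csν_inr, csT_inl, csT_inr, csD_inl, csD_inr, csΦ_inl, csΦ_inr,
    csX_apply, csY_apply]
  module

/-- **Row A1cs (finite COMPLEX SIMPLE temporal spectrum)** — census A-block cell, (L′)-shape over the
genuine class `IsTypeIAncientMild C u` BY NAME: if on `t < 0`
`u(t,x) = ∑ₖ e^{aₖt}(cos(bₖt) ψₖ(x) + sin(bₖt) χₖ(x))` with finitely many DISTINCT rates `aₖ + i bₖ`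
(normalised `bₖ ≥ 0`; the modes with `bₖ = 0` are the real rates, their `χₖ` being irrelevant) and `C³`
coefficient fields with bounded curls, then `u ≡ 0` on `t < 0`.  Contains `Row_A1ex` (all `bₖ = 0`)
and `Row_A1cx` (one pair) as special cases; the Jordan blocks (`Row_A1po`, `Row_A1jb`) are the
complementary decided cells.  No shell, closure, symmetry, periodicity or integrability hypothesis. -/
def Row_A1cs : Prop :=
  ∀ (C : ℝ) (u : ℝ → E3 → E3), IsTypeIAncientMild C u →
  ∀ (n : ℕ) (a b : Fin n → ℝ) (ψ χ : Fin n → E3 → E3),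
    (∀ k, 0 ≤ b k) → Function.Injective (fun k => (a k, b k)) →
    (∀ k, ContDiff ℝ 3 (ψ k)) → (∀ k, ContDiff ℝ 3 (χ k)) →
    (∀ k, ∃ A : ℝ, ∀ x, ‖curl (ψ k) x‖ ≤ A) → (∀ k, ∃ A : ℝ, ∀ x, ‖curl (χ k) x‖ ≤ A) →
    (∀ t < 0, ∀ x, u t x = ∑ k, Real.exp (a k * t) •
        (Real.cos (b k * t) • ψ k x + Real.sin (b k * t) • χ k x)) →
    ∀ t < 0, ∀ x, u t x = 0

end Summit.NavierStokesRegularity.NavierStokesRegularity.Theorems.ScenarioCensus.TemporalSpectrum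

end
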